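import Mathlib
import HarnessLib

/-!
# The discrete stable-manifold ("fine-tuning") theorem for scale-indexed renormalisation-group
# recursions with a finite horizon, I: existence of the tuned trajectory
# (Brydges 2009, Thm 2.16; Adams–Buchholz–Kotecký–Müller 2019, Thm 12.1 — existence part)

Topic `Literature/Dynamics/Hyperbolic`.  A renormalisation-group (RG) flow in the
Brydges–Yau / Bauerschmidt–Brydges–Slade / Adams–Kotecký–Müller format is a finite sequence of maps
between scale-dependent Banach spaces,
`T_k : E_k × F_k → E_{k+1} × F_{k+1}`, `k = 0, …, N-1`,
acting on a RELEVANT coordinate `x_k ∈ E_k` (the "relevant Hamiltonian" `H_k`) and an IRRELEVANT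
coordinate `y_k ∈ F_k` (the "polymer activity" `K_k`), of the triangular form
`T_k(x, y) = (A_k x + B_k y, S_k(x, y))`, `S_k(0,0) = 0`,
with `A_k` invertible, `‖A_k⁻¹‖ ≤ α` (relevant directions do not contract), `‖B_k‖ ≤ β`, and `S_k`
Lipschitz with a SMALL constant `σ` near the origin (irrelevant directions contract).  The initial
irrelevant coordinate `y_0` is given (the model's perturbation); the initial relevant coordinate
`x_0` is free and must be TUNED so that the final relevant coordinate vanishes, `x_N = 0`; the
tuned trajectory then stays exponentially small, `‖x_k‖, ‖y_k‖ ≤ ε η^k`.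

This is Brydges' stable manifold theorem [Bry09, §2.10, Thm 2.16] in the finite-horizon form in
which Adams–Buchholz–Kotecký–Müller use it [ABKM19, Ch. 12, Thm 12.1]: following [Bry09, (2.41)] /
[ABKM19, (12.4)–(12.8)] the recursion with the two-point boundary condition (`y_0` given,
`x_N = 0`) is a fixed-point problem for an operator `𝒯` on whole trajectories with the weighted
norm `sup_k η^{-k} max(‖x_k‖, ‖y_k‖)`, the relevant equation being solved BACKWARDS
(`x_k = A_k⁻¹(x_{k+1} - B_k y_k)`) and the irrelevant one forwards; `𝒯` is a contraction with
constant `κ ≥ max(α(η+β), σ/η)`, `κ < 1`, of a closed ball ([Bry09] (2.44)–(2.46), [ABKM19]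
(12.43)–(12.48)), and the Banach fixed-point theorem yields the tuned trajectory and its bounds.
The companion file `RGFlowStableManifoldLipschitz.lean` proves uniqueness, Lipschitz dependence on
the data, and the second fixed point of [ABKM19, Lemma 12.6].

## Contents (everything is proved; no named fact is introduced)

* `RGFlow.IsTrajectory N A B S y₀ x y`, `RGFlow.InTube N η ε x y`, `RGFlow.IsRGStep N r α β σ A B S`
  — trajectories with the boundary conditions, the exponential tube, the hypotheses on the steps.
* `RGFlow.TrajSpace`, `RGFlow.uAt`, `RGFlow.vAt`, `RGFlow.trajMap` — the trajectory space (sup norm)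
  in rescaled coordinates `u_k = η^{-k}x_k`, `v_k = η^{-k}y_k` and the operator `𝒯`.
* `RGFlow.lipschitz_trajMap`, `RGFlow.norm_trajMap_zero_le`, `RGFlow.norm_trajMap_le` — `𝒯` is a
  `κ`-contraction of the closed `ε`-ball (`ε ≤ r`, `‖y₀‖ ≤ (1-κ)ε`).
* `exists_fixedPt_of_lipschitz_of_norm_le` — Banach's fixed-point theorem on a closed ball
  of a Banach space (generic).
* **`RGFlow.exists_isTrajectory`** — the tuned trajectory exists, with
  `‖x_k‖, ‖y_k‖ ≤ η^k ‖y₀‖ / (1-κ)`.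

## Design

* Scale-dependent spaces are families `E F : ℕ → Type*` of real Banach spaces; trajectories are
  total sequences `x : Π k, E k`, `y : Π k, F k`, constrained only for `k ≤ N`.
  `A k : E k ≃L[ℝ] E (k+1)`, `B k : F k →L[ℝ] E (k+1)`, `S k : E k → F k → F (k+1)` (only the
  restriction of `S k` to the `r`-ball matters); operator bounds are stated pointwise.
* We assume a Lipschitz bound for `S_k` near the origin instead of the source's `C²` bounds plus
  the contraction `‖C_k‖ ≤ θ` of `C_k = D_y S_k(0,0)`; the former follows from the latter with
  `σ = θ + O(r)` and is what the contraction argument consumes.  Smoothness of the tuned trajectory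
  in parameters (the implicit-function half of Thm 12.1) is not treated.
* All coordinate statements about `𝒯` are indexed by natural numbers through `uAt`/`vAt`
  (never through `Fin.succ`), which keeps the dependent types `E k`, `F k` syntactically aligned.

## References
* [Bry09] D. C. Brydges, *Lectures on the renormalisation group*, IAS/Park City Math. Ser. 16
  (2009), §2.10 Appendix, Theorem 2.16 and its proof, eqs. (2.38)–(2.46) [Brydges2009].
* [ABKM19] S. Adams, S. Buchholz, R. Kotecký, S. Müller, *Cauchy–Born rule from microscopic
  models with non-convex potentials*, arXiv:1910.13564, Ch. 12: (12.1)–(12.8), Theorem 12.1,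
  (12.43)–(12.48) [AdamsBuchholzKoteckyMuller2019].
-/

noncomputable section

open Set Function Metric Filter
open scoped NNReal Topology

namespace Literature.Dynamics.Hyperbolic

/-! ## §0 Banach's fixed-point theorem on a closed ball (generic) -/

/-- **Contraction principle on a closed ball.**  If `T` is `κ`-Lipschitz (`0 ≤ κ < 1`) on the
closed `ε`-ball of a Banach space and maps it into itself, then `T` has a fixed point `z` in the
ball with `‖z‖ ≤ ‖T 0‖ / (1 - κ)`, and it is the only fixed point in the ball — verbatim the
step "by the Banach fixed point theorem, there is a unique `Ẑ ∈ B̄_ε` such that `𝒯(Ẑ) = Ẑ`.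
Moreover `‖Ẑ‖ ≤ 8‖𝒯(0)‖`" of [ABKM19] after (12.48) (there `κ = 7/8`); also the fixed-point
principle inside [Bry09] Thm 2.16. [cite: AdamsBuchholzKoteckyMuller2019, Ch. 12, eqs. (12.48)–(12.49)] -/
theorem exists_fixedPt_of_lipschitz_of_norm_le {X : Type*} [NormedAddCommGroup X]
    [CompleteSpace X] {T : X → X} {κ ε : ℝ} (hκ0 : 0 ≤ κ) (hκ1 : κ < 1) (hε : 0 ≤ ε)
    (hlip : ∀ z z', ‖z‖ ≤ ε → ‖z'‖ ≤ ε → ‖T z - T z'‖ ≤ κ * ‖z - z'‖)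
    (hmaps : ∀ z, ‖z‖ ≤ ε → ‖T z‖ ≤ ε) :
    ∃ z, ‖z‖ ≤ ε ∧ T z = z ∧ ‖z‖ ≤ ‖T 0‖ / (1 - κ) ∧
      ∀ z', ‖z'‖ ≤ ε → T z' = z' → z' = z := by
  set s : Set X := closedBall (0 : X) ε with hs
  have hsc : IsComplete s := isClosed_closedBall.isComplete
  have hmem : ∀ {z : X}, z ∈ s ↔ ‖z‖ ≤ ε := by intro z; simp [hs]
  have hsf : MapsTo T s s := fun z hz => hmem.2 (hmaps z (hmem.1 hz))
  have hK : ContractingWith ⟨κ, hκ0⟩ (hsf.restrict T s s) := by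
    refine ⟨by exact_mod_cast hκ1, LipschitzWith.of_dist_le_mul fun a b => ?_⟩
    simp only [Subtype.dist_eq, MapsTo.val_restrict_apply, dist_eq_norm]
    exact hlip _ _ (hmem.1 a.2) (hmem.1 b.2)
  have h0 : (0 : X) ∈ s := hmem.2 (by simpa using hε)
  obtain ⟨z, hzs, hfix, -⟩ :=
    ContractingWith.exists_fixedPoint' hsc hsf hK h0 (edist_ne_top _ _)
  have hz : ‖z‖ ≤ ε := hmem.1 hzs
  refine ⟨z, hz, hfix, ?_, ?_⟩
  · have h1 : ‖z‖ ≤ κ * ‖z‖ + ‖T 0‖ := by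
      have h2 := hlip z 0 hz (by simpa using hε)
      rw [sub_zero] at h2
      calc ‖z‖ = ‖(T z - T 0) + T 0‖ := by rw [sub_add_cancel, hfix.eq]
        _ ≤ ‖T z - T 0‖ + ‖T 0‖ := norm_add_le _ _
        _ ≤ κ * ‖z‖ + ‖T 0‖ := by gcongr
    rw [le_div_iff₀ (by linarith)]
    nlinarith
  · intro z' hz' hfix'
    have h1 := hlip z' z hz' hz
    rw [hfix', hfix.eq] at h1
    have h3 : ‖z' - z‖ ≤ 0 := by
      by_contra h
      push Not at h
      nlinarith
    exact sub_eq_zero.1 (norm_le_zero_iff.1 h3)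

namespace RGFlow

variable {E F : ℕ → Type*} [∀ k, NormedAddCommGroup (E k)] [∀ k, NormedSpace ℝ (E k)]
  [∀ k, NormedAddCommGroup (F k)] [∀ k, NormedSpace ℝ (F k)]

/-! ## §1 Trajectories, tubes, and the hypotheses on one RG step -/

/-- `(x, y)` is a TUNED TRAJECTORY of horizon `N` of the scale recursion
`x_{k+1} = A_k x_k + B_k y_k`, `y_{k+1} = S_k(x_k, y_k)` (`k < N`) with initial irrelevant
coordinate `y_0 = y₀` and final relevant coordinate `x_N = 0` ([Bry09] (2.38) with the boundary
conditions of [ABKM19] (12.9): `H_N = 0`, `K_0` given).  Indices `k > N` are unconstrained.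
[cite: AdamsBuchholzKoteckyMuller2019, Ch. 12, eq. (12.9)] -/
structure IsTrajectory (N : ℕ) (A : ∀ k, E k ≃L[ℝ] E (k + 1)) (B : ∀ k, F k →L[ℝ] E (k + 1))
    (S : ∀ k, E k → F k → F (k + 1)) (y₀ : F 0) (x : ∀ k, E k) (y : ∀ k, F k) : Prop where
  /-- initial irrelevant coordinate -/
  init : y 0 = y₀
  /-- the irrelevant (forward) recursion -/
  irrel : ∀ k, k < N → y (k + 1) = S k (x k) (y k)
  /-- the relevant (linear) recursion -/
  rel : ∀ k, k < N → x (k + 1) = A k (x k) + B k (y k)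
  /-- the tuning condition: the final relevant coordinate vanishes -/
  final : x N = 0

/-- `(x, y)` lies in the `ε`-tube with decay rate `η` up to the horizon: `‖x_k‖ ≤ ε η^k` and
`‖y_k‖ ≤ ε η^k` for `k ≤ N` (membership of the rescaled trajectory in the closed `ε`-ball of the
trajectory space `𝒵` of [ABKM19] (12.1)–(12.2)).
[cite: AdamsBuchholzKoteckyMuller2019, Ch. 12, eq. (12.2)] -/
def InTube (N : ℕ) (η ε : ℝ) (x : ∀ k, E k) (y : ∀ k, F k) : Prop :=
  ∀ k, k ≤ N → ‖x k‖ ≤ ε * η ^ k ∧ ‖y k‖ ≤ ε * η ^ k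

/-- Hypotheses on the RG steps `T_k(x,y) = (A_k x + B_k y, S_k(x,y))`, `k < N`: `S_k(0,0) = 0`;
`S_k` is `σ`-Lipschitz on the closed `r`-ball (for the max norm of `E_k × F_k`); `‖A_k⁻¹‖ ≤ α`;
`‖B_k‖ ≤ β` (pointwise).  This packages the conclusions of [ABKM19] Thm 6.7 (smoothness near the
origin) and Thm 6.8 (`‖(A_k^{(q)})⁻¹‖ ≤ α`, `‖B_k^{(q)}‖ ≤ β`, `‖C_k^{(q)}‖ ≤ θ`, whence
`σ = θ + O(r)`) in the form the contraction argument of Ch. 12 uses.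
[cite: AdamsBuchholzKoteckyMuller2019, Thm 6.8] -/
structure IsRGStep (N : ℕ) (r α β σ : ℝ) (A : ∀ k, E k ≃L[ℝ] E (k + 1))
    (B : ∀ k, F k →L[ℝ] E (k + 1)) (S : ∀ k, E k → F k → F (k + 1)) : Prop where
  /-- the origin is a fixed point of every step -/
  map_zero : ∀ k, k < N → S k 0 0 = 0
  /-- `S_k` is `σ`-Lipschitz on the `r`-ball -/
  lipschitz : ∀ k, k < N → ∀ (x x' : E k) (y y' : F k), ‖x‖ ≤ r → ‖x'‖ ≤ r → ‖y‖ ≤ r →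
    ‖y'‖ ≤ r → ‖S k x y - S k x' y'‖ ≤ σ * max ‖x - x'‖ ‖y - y'‖
  /-- `‖A_k⁻¹‖ ≤ α` -/
  norm_symm_le : ∀ k, k < N → ∀ w : E (k + 1), ‖(A k).symm w‖ ≤ α * ‖w‖
  /-- `‖B_k‖ ≤ β` -/
  norm_B_le : ∀ k, k < N → ∀ v : F k, ‖B k v‖ ≤ β * ‖v‖

/-! ## §2 The trajectory space and the operator `𝒯` in rescaled coordinates -/

/-- The space of rescaled trajectories `z = (u_k, v_k)_{k ≤ N}`, `u_k = η^{-k} x_k ∈ E_k`,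
`v_k = η^{-k} y_k ∈ F_k`, with the supremum (of the max) norm — the space `𝒵` of [ABKM19] (12.1)
with the norm (12.2) transported to unweighted coordinates (`y_0` and `x_N` kept as coordinates).
[cite: AdamsBuchholzKoteckyMuller2019, Ch. 12, eq. (12.1)] -/
abbrev TrajSpace (E F : ℕ → Type*) [∀ k, NormedAddCommGroup (E k)]
    [∀ k, NormedAddCommGroup (F k)] (N : ℕ) : Type _ :=
  ∀ k : Fin (N + 1), E k × F k

/-- The relevant coordinate `u_k` of a rescaled trajectory (`0` beyond the horizon). [folklore] -/
def uAt (N : ℕ) (z : TrajSpace E F N) (k : ℕ) : E k :=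
  if h : k < N + 1 then (z ⟨k, h⟩).1 else 0

/-- The irrelevant coordinate `v_k` of a rescaled trajectory (`0` beyond the horizon). [folklore] -/
def vAt (N : ℕ) (z : TrajSpace E F N) (k : ℕ) : F k :=
  if h : k < N + 1 then (z ⟨k, h⟩).2 else 0

/-- The trajectory operator `𝒯` ([Bry09] (2.41); [ABKM19] (12.4)–(12.8)) in rescaled
coordinates: the relevant equation solved backwards from `u_N := 0`,
`(𝒯z).u_k = A_k⁻¹ (η u_{k+1} - B_k v_k)` (`k < N`), and the irrelevant one forwards from
`v_0 := y₀`, `(𝒯z).v_{k+1} = η^{-(k+1)} S_k(η^k u_k, η^k v_k)`.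
[cite: AdamsBuchholzKoteckyMuller2019, Ch. 12, eqs. (12.4)–(12.8)] -/
def trajMap (N : ℕ) (η : ℝ) (A : ∀ k, E k ≃L[ℝ] E (k + 1)) (B : ∀ k, F k →L[ℝ] E (k + 1))
    (S : ∀ k, E k → F k → F (k + 1)) (y₀ : F 0) (z : TrajSpace E F N) : TrajSpace E F N :=
  fun k =>
  (if (k : ℕ) < N then (A k).symm (η • uAt N z (k + 1) - B k (vAt N z k)) else 0,
   Fin.cases (motive := fun k : Fin (N + 1) => F k) y₀
      (fun j : Fin N =>
        (η ^ ((j : ℕ) + 1))⁻¹ • S j (η ^ (j : ℕ) • uAt N z j) (η ^ (j : ℕ) • vAt N z j)) k)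

section basic

variable {N : ℕ} {η : ℝ} {A : ∀ k, E k ≃L[ℝ] E (k + 1)} {B : ∀ k, F k →L[ℝ] E (k + 1)}
  {S : ∀ k, E k → F k → F (k + 1)} {y₀ : F 0}

omit [∀ k, NormedSpace ℝ (E k)] [∀ k, NormedSpace ℝ (F k)] in
/-- `u_k` agrees with the `k`-th first component. [folklore] -/
private theorem uAt_eq (z : TrajSpace E F N) (k : Fin (N + 1)) : uAt N z k = (z k).1 :=
  dif_pos k.isLt

omit [∀ k, NormedSpace ℝ (E k)] [∀ k, NormedSpace ℝ (F k)] in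
/-- `v_k` agrees with the `k`-th second component. [folklore] -/
private theorem vAt_eq (z : TrajSpace E F N) (k : Fin (N + 1)) : vAt N z k = (z k).2 :=
  dif_pos k.isLt

omit [∀ k, NormedSpace ℝ (E k)] [∀ k, NormedSpace ℝ (F k)] in
/-- `u` is additive: coordinates of a difference. [folklore] -/
private theorem uAt_sub (z z' : TrajSpace E F N) (k : ℕ) :
    uAt N (z - z') k = uAt N z k - uAt N z' k := by
  unfold uAt; split_ifs <;> simp

omit [∀ k, NormedSpace ℝ (E k)] [∀ k, NormedSpace ℝ (F k)] in
/-- `v` is additive: coordinates of a difference. [folklore] -/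
private theorem vAt_sub (z z' : TrajSpace E F N) (k : ℕ) :
    vAt N (z - z') k = vAt N z k - vAt N z' k := by
  unfold vAt; split_ifs <;> simp

omit [∀ k, NormedSpace ℝ (E k)] [∀ k, NormedSpace ℝ (F k)] in
/-- Coordinate bound `‖u_k‖ ≤ ‖z‖`. [folklore] -/
private theorem norm_uAt_le (z : TrajSpace E F N) (k : ℕ) : ‖uAt N z k‖ ≤ ‖z‖ := by
  unfold uAt
  split_ifs with h
  · exact (norm_fst_le _).trans (norm_le_pi_norm z ⟨k, h⟩)
  · simp

omit [∀ k, NormedSpace ℝ (E k)] [∀ k, NormedSpace ℝ (F k)] in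
/-- Coordinate bound `‖v_k‖ ≤ ‖z‖`. [folklore] -/
private theorem norm_vAt_le (z : TrajSpace E F N) (k : ℕ) : ‖vAt N z k‖ ≤ ‖z‖ := by
  unfold vAt
  split_ifs with h
  · exact (norm_snd_le _).trans (norm_le_pi_norm z ⟨k, h⟩)
  · simp

omit [∀ k, NormedSpace ℝ (E k)] [∀ k, NormedSpace ℝ (F k)] in
/-- A bound on all coordinates up to the horizon bounds the trajectory norm. [folklore] -/
private theorem norm_le_of_forall_le {z : TrajSpace E F N} {C : ℝ} (hC : 0 ≤ C)
    (h : ∀ k, k ≤ N → ‖uAt N z k‖ ≤ C ∧ ‖vAt N z k‖ ≤ C) : ‖z‖ ≤ C := by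
  refine (pi_norm_le_iff_of_nonneg hC).2 fun k => ?_
  have hk : (k : ℕ) ≤ N := Nat.lt_succ_iff.1 k.isLt
  rw [Prod.norm_def, ← uAt_eq, ← vAt_eq]
  exact max_le (h k hk).1 (h k hk).2

/-- The relevant component of `𝒯z` below the horizon ([ABKM19] (12.4)–(12.6) without the
tuning term). [cite: AdamsBuchholzKoteckyMuller2019, Ch. 12, eq. (12.5)] -/
theorem uAt_trajMap {z : TrajSpace E F N} {k : ℕ} (hk : k < N) :
    uAt N (trajMap N η A B S y₀ z) k = (A k).symm (η • uAt N z (k + 1) - B k (vAt N z k)) := by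
  have hk' : k < N + 1 := Nat.lt_succ_of_lt hk
  simp [uAt, trajMap, hk, hk']

/-- The relevant component of `𝒯z` at the horizon is `0` (the tuning condition `H_N = 0`,
[ABKM19] (12.6)). [cite: AdamsBuchholzKoteckyMuller2019, Ch. 12, eq. (12.6)] -/
theorem uAt_trajMap_self (z : TrajSpace E F N) : uAt N (trajMap N η A B S y₀ z) N = 0 := by
  simp [uAt, trajMap]

/-- The irrelevant component of `𝒯z` at scale `0` is the datum `y₀` ([ABKM19] (12.3)).
[cite: AdamsBuchholzKoteckyMuller2019, Ch. 12, eq. (12.3)] -/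
theorem vAt_trajMap_zero (z : TrajSpace E F N) : vAt N (trajMap N η A B S y₀ z) 0 = y₀ := by
  simp only [vAt, trajMap, Nat.zero_lt_succ, dif_pos]
  rfl

/-- The irrelevant component of `𝒯z` above scale `0` ([ABKM19] (12.7)–(12.8)).
[cite: AdamsBuchholzKoteckyMuller2019, Ch. 12, eq. (12.7)] -/
theorem vAt_trajMap_succ {z : TrajSpace E F N} {k : ℕ} (hk : k < N) :
    vAt N (trajMap N η A B S y₀ z) (k + 1) =
      (η ^ (k + 1))⁻¹ • S k (η ^ k • uAt N z k) (η ^ k • vAt N z k) := by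
  have hk' : k + 1 < N + 1 := Nat.succ_lt_succ hk
  simp only [vAt, trajMap, hk', dif_pos]
  rfl

end basic

/-! ## §3 `𝒯` is a contraction of a small ball ([Bry09] (2.44)–(2.46); [ABKM19] (12.43)–(12.48)) -/

section contraction

variable {N : ℕ} {r α β σ η κ ε : ℝ} {A : ∀ k, E k ≃L[ℝ] E (k + 1)}
  {B : ∀ k, F k →L[ℝ] E (k + 1)} {S : ∀ k, E k → F k → F (k + 1)} {y₀ : F 0}

/-- **`𝒯` is `κ`-Lipschitz on the closed `ε`-ball** (`ε ≤ r`, `α(η+β) ≤ κ`, `σ ≤ κη`): the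
relevant components contract by `α(η + β)` because the backward equation gains a factor `η` from
the weight ([ABKM19] (12.43); [Bry09] (2.44), first line), the irrelevant ones by `σ/η`
([ABKM19] (12.44); [Bry09] (2.44), second line).
[cite: AdamsBuchholzKoteckyMuller2019, Ch. 12, eqs. (12.43)–(12.46)] -/
theorem lipschitz_trajMap (hT : IsRGStep N r α β σ A B S) (hη : 0 < η) (hη1 : η ≤ 1)
    (hα : 0 ≤ α) (hβ : 0 ≤ β) (hσ : 0 ≤ σ) (hκ₁ : α * (η + β) ≤ κ) (hκ₂ : σ ≤ κ * η)
    (hεr : ε ≤ r) {z z' : TrajSpace E F N} (hz : ‖z‖ ≤ ε) (hz' : ‖z'‖ ≤ ε) :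
    ‖trajMap N η A B S y₀ z - trajMap N η A B S y₀ z'‖ ≤ κ * ‖z - z'‖ := by
  have hκ0 : 0 ≤ κ := le_trans (mul_nonneg hα (add_nonneg hη.le hβ)) hκ₁
  have hdu : ∀ k, ‖uAt N z k - uAt N z' k‖ ≤ ‖z - z'‖ := fun k => by
    rw [← uAt_sub]; exact norm_uAt_le _ _
  have hdv : ∀ k, ‖vAt N z k - vAt N z' k‖ ≤ ‖z - z'‖ := fun k => by
    rw [← vAt_sub]; exact norm_vAt_le _ _
  -- inputs of `S_k` stay in the `r`-ball
  have hin : ∀ (w : TrajSpace E F N), ‖w‖ ≤ ε → ∀ k : ℕ,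
      ‖η ^ k • uAt N w k‖ ≤ r ∧ ‖η ^ k • vAt N w k‖ ≤ r := by
    intro w hw k
    have hηk : 0 ≤ η ^ k := pow_nonneg hη.le _
    have hηk1 : η ^ k ≤ 1 := pow_le_one₀ hη.le hη1
    constructor
    · rw [norm_smul, Real.norm_of_nonneg hηk]
      calc η ^ k * ‖uAt N w k‖ ≤ 1 * ‖uAt N w k‖ :=
            mul_le_mul_of_nonneg_right hηk1 (norm_nonneg _)
        _ ≤ r := by rw [one_mul]; exact ((norm_uAt_le w k).trans hw).trans hεr
    · rw [norm_smul, Real.norm_of_nonneg hηk]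
      calc η ^ k * ‖vAt N w k‖ ≤ 1 * ‖vAt N w k‖ :=
            mul_le_mul_of_nonneg_right hηk1 (norm_nonneg _)
        _ ≤ r := by rw [one_mul]; exact ((norm_vAt_le w k).trans hw).trans hεr
  refine norm_le_of_forall_le (mul_nonneg hκ0 (norm_nonneg _)) fun k hk => ⟨?_, ?_⟩
  · -- relevant component
    rw [uAt_sub]
    rcases Nat.lt_or_ge k N with hkN | hkN
    · rw [uAt_trajMap hkN, uAt_trajMap hkN, ← map_sub]
      have hlin : η • uAt N z (k + 1) - B k (vAt N z k) - (η • uAt N z' (k + 1) - B k (vAt N z' k))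
          = η • (uAt N z (k + 1) - uAt N z' (k + 1)) - B k (vAt N z k - vAt N z' k) := by
        rw [map_sub, smul_sub]; abel
      rw [hlin]
      calc ‖(A k).symm (η • (uAt N z (k + 1) - uAt N z' (k + 1)) -
              B k (vAt N z k - vAt N z' k))‖
          ≤ α * ‖η • (uAt N z (k + 1) - uAt N z' (k + 1)) - B k (vAt N z k - vAt N z' k)‖ :=
            hT.norm_symm_le k hkN _
        _ ≤ α * (η * ‖z - z'‖ + β * ‖z - z'‖) := by
            refine mul_le_mul_of_nonneg_left ((norm_sub_le _ _).trans (add_le_add ?_ ?_)) hα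
            · rw [norm_smul, Real.norm_of_nonneg hη.le]
              exact mul_le_mul_of_nonneg_left (hdu (k + 1)) hη.le
            · exact (hT.norm_B_le k hkN _).trans (mul_le_mul_of_nonneg_left (hdv k) hβ)
        _ = α * (η + β) * ‖z - z'‖ := by ring
        _ ≤ κ * ‖z - z'‖ := mul_le_mul_of_nonneg_right hκ₁ (norm_nonneg _)
    · obtain rfl : k = N := le_antisymm hk hkN
      rw [uAt_trajMap_self, uAt_trajMap_self, sub_zero, norm_zero]
      exact mul_nonneg hκ0 (norm_nonneg _)
  · -- irrelevant component
    rw [vAt_sub]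
    rcases Nat.eq_zero_or_eq_succ_pred k with hk0 | hks
    · subst hk0
      rw [vAt_trajMap_zero, vAt_trajMap_zero, sub_self, norm_zero]
      exact mul_nonneg hκ0 (norm_nonneg _)
    · set j := k.pred with hj
      rw [hks] at hk
      have hjN : j < N := Nat.lt_of_succ_le hk
      rw [hks, vAt_trajMap_succ hjN, vAt_trajMap_succ hjN, ← smul_sub, norm_smul, norm_inv,
        Real.norm_of_nonneg (pow_pos hη _).le]
      have hηj : 0 ≤ η ^ j := pow_nonneg hη.le _
      have hS := hT.lipschitz j hjN _ _ _ _ (hin z hz j).1 (hin z' hz' j).1 (hin z hz j).2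
        (hin z' hz' j).2
      rw [← smul_sub, ← smul_sub, norm_smul, norm_smul, Real.norm_of_nonneg hηj] at hS
      have hmax : max (η ^ j * ‖uAt N z j - uAt N z' j‖) (η ^ j * ‖vAt N z j - vAt N z' j‖)
          ≤ η ^ j * ‖z - z'‖ :=
        max_le (mul_le_mul_of_nonneg_left (hdu j) hηj) (mul_le_mul_of_nonneg_left (hdv j) hηj)
      calc (η ^ (j + 1))⁻¹ * ‖S j (η ^ j • uAt N z j) (η ^ j • vAt N z j) -
              S j (η ^ j • uAt N z' j) (η ^ j • vAt N z' j)‖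
          ≤ (η ^ (j + 1))⁻¹ * (σ * (η ^ j * ‖z - z'‖)) :=
            mul_le_mul_of_nonneg_left (hS.trans (mul_le_mul_of_nonneg_left hmax hσ))
              (inv_nonneg.2 (pow_pos hη _).le)
        _ = σ / η * ‖z - z'‖ := by rw [pow_succ]; field_simp
        _ ≤ κ * ‖z - z'‖ := by
            refine mul_le_mul_of_nonneg_right ?_ (norm_nonneg _)
            rw [div_le_iff₀ hη]; exact hκ₂

/-- `‖𝒯 0‖ ≤ ‖y₀‖`: at the origin only the datum survives (`S_k(0,0) = 0`), cf. [ABKM19]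
"`𝒯(0, ℋ, 0) = 0`" before (12.47). [cite: AdamsBuchholzKoteckyMuller2019, Ch. 12, eq. (12.47)] -/
theorem norm_trajMap_zero_le (hT : IsRGStep N r α β σ A B S) :
    ‖trajMap N η A B S y₀ (0 : TrajSpace E F N)‖ ≤ ‖y₀‖ := by
  have hu0 : ∀ k, uAt N (0 : TrajSpace E F N) k = 0 := fun k => by
    unfold uAt; split_ifs <;> simp
  have hv0 : ∀ k, vAt N (0 : TrajSpace E F N) k = 0 := fun k => by
    unfold vAt; split_ifs <;> simp
  refine norm_le_of_forall_le (norm_nonneg _) fun k hk => ⟨?_, ?_⟩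
  · rcases Nat.lt_or_ge k N with hkN | hkN
    · rw [uAt_trajMap hkN, hu0, hv0, smul_zero, map_zero, sub_zero, map_zero, norm_zero]
      exact norm_nonneg _
    · obtain rfl : k = N := le_antisymm hk hkN
      rw [uAt_trajMap_self, norm_zero]; exact norm_nonneg _
  · rcases Nat.eq_zero_or_eq_succ_pred k with hk0 | hks
    · subst hk0; rw [vAt_trajMap_zero]
    · rw [hks] at hk ⊢
      rw [vAt_trajMap_succ (Nat.lt_of_succ_le hk), hu0, hv0, smul_zero, smul_zero,
        hT.map_zero _ (Nat.lt_of_succ_le hk), smul_zero, norm_zero]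
      exact norm_nonneg _

/-- **`𝒯` maps the closed `ε`-ball into itself** when `‖y₀‖ ≤ (1 - κ) ε` ([ABKM19] (12.47)–(12.48);
[Bry09] proof of Thm 2.16). [cite: AdamsBuchholzKoteckyMuller2019, Ch. 12, eq. (12.48)] -/
theorem norm_trajMap_le (hT : IsRGStep N r α β σ A B S) (hη : 0 < η) (hη1 : η ≤ 1)
    (hα : 0 ≤ α) (hβ : 0 ≤ β) (hσ : 0 ≤ σ) (hκ₁ : α * (η + β) ≤ κ) (hκ₂ : σ ≤ κ * η)
    (hε : 0 ≤ ε) (hεr : ε ≤ r) (hy₀ : ‖y₀‖ ≤ (1 - κ) * ε) {z : TrajSpace E F N} (hz : ‖z‖ ≤ ε) :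
    ‖trajMap N η A B S y₀ z‖ ≤ ε := by
  have h1 := lipschitz_trajMap (y₀ := y₀) hT hη hη1 hα hβ hσ hκ₁ hκ₂ hεr hz
    (by simpa using hε : ‖(0 : TrajSpace E F N)‖ ≤ ε)
  rw [sub_zero] at h1
  have h2 := norm_trajMap_zero_le (η := η) (y₀ := y₀) hT
  have hκ0 : 0 ≤ κ := le_trans (mul_nonneg hα (add_nonneg hη.le hβ)) hκ₁
  calc ‖trajMap N η A B S y₀ z‖
      = ‖(trajMap N η A B S y₀ z - trajMap N η A B S y₀ 0) + trajMap N η A B S y₀ 0‖ := by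
        rw [sub_add_cancel]
    _ ≤ ‖trajMap N η A B S y₀ z - trajMap N η A B S y₀ 0‖ + ‖trajMap N η A B S y₀ 0‖ :=
        norm_add_le _ _
    _ ≤ κ * ‖z‖ + ‖y₀‖ := add_le_add h1 h2
    _ ≤ κ * ε + (1 - κ) * ε := add_le_add (mul_le_mul_of_nonneg_left hz hκ0) hy₀
    _ = ε := by ring

end contraction

/-! ## §4 Existence of the tuned trajectory ([Bry09] Thm 2.16; [ABKM19] Thm 12.1, existence) -/

section existence

variable {N : ℕ} {r α β σ η κ ε : ℝ} {A : ∀ k, E k ≃L[ℝ] E (k + 1)}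
  {B : ∀ k, F k →L[ℝ] E (k + 1)} {S : ∀ k, E k → F k → F (k + 1)} {y₀ : F 0}

/-- A fixed point of `𝒯` in rescaled coordinates is a tuned trajectory:
`x_k = η^k u_k`, `y_k = η^k v_k`. [cite: AdamsBuchholzKoteckyMuller2019, Ch. 12, eq. (12.9)] -/
theorem isTrajectory_of_fixedPt (hη : 0 < η) {z : TrajSpace E F N}
    (hfix : trajMap N η A B S y₀ z = z) :
    IsTrajectory N A B S y₀ (fun k => η ^ k • uAt N z k) (fun k => η ^ k • vAt N z k) := by
  refine ⟨?_, ?_, ?_, ?_⟩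
  · simp only [pow_zero, one_smul]
    rw [← hfix, vAt_trajMap_zero]
  · intro k hk
    conv_lhs => rw [← hfix, vAt_trajMap_succ hk]
    rw [smul_smul, mul_inv_cancel₀ (pow_ne_zero _ hη.ne'), one_smul]
  · intro k hk
    have hu : uAt N z k = (A k).symm (η • uAt N z (k + 1) - B k (vAt N z k)) := by
      conv_lhs => rw [← hfix, uAt_trajMap hk]
    have hA : A k (uAt N z k) = η • uAt N z (k + 1) - B k (vAt N z k) := by
      rw [hu, ContinuousLinearEquiv.apply_symm_apply]
    rw [map_smul, map_smul, hA, pow_succ, mul_comm, ← smul_smul, smul_sub, sub_add_cancel,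
      smul_comm]
  · rw [← hfix, uAt_trajMap_self, smul_zero]

variable [∀ k, CompleteSpace (E k)] [∀ k, CompleteSpace (F k)]

/-- **Existence of the tuned trajectory** (Brydges' stable manifold theorem, finite horizon;
[ABKM19] Thm 12.1, existence and bounds).  Under `IsRGStep N r α β σ A B S` with rates
`0 < η ≤ 1`, `α(η + β) ≤ κ < 1`, `σ ≤ κη`, for every datum with `‖y₀‖ ≤ (1-κ) ε`, `0 ≤ ε ≤ r`,
there is a trajectory `x_{k+1} = A_k x_k + B_k y_k`, `y_{k+1} = S_k(x_k,y_k)` (`k < N`) with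
`y_0 = y₀` and `x_N = 0`, lying in the `ε`-tube and obeying the sharper bounds
`‖x_k‖, ‖y_k‖ ≤ η^k ‖y₀‖/(1-κ)` (`k ≤ N`).
[cite: AdamsBuchholzKoteckyMuller2019, Thm 12.1] -/
theorem exists_isTrajectory (hT : IsRGStep N r α β σ A B S) (hη : 0 < η) (hη1 : η ≤ 1)
    (hα : 0 ≤ α) (hβ : 0 ≤ β) (hσ : 0 ≤ σ) (hκ₁ : α * (η + β) ≤ κ) (hκ₂ : σ ≤ κ * η)
    (hκ : κ < 1) (hε : 0 ≤ ε) (hεr : ε ≤ r) (hy₀ : ‖y₀‖ ≤ (1 - κ) * ε) :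
    ∃ (x : ∀ k, E k) (y : ∀ k, F k), IsTrajectory N A B S y₀ x y ∧ InTube N η ε x y ∧
      ∀ k, k ≤ N → ‖x k‖ ≤ η ^ k * (‖y₀‖ / (1 - κ)) ∧ ‖y k‖ ≤ η ^ k * (‖y₀‖ / (1 - κ)) := by
  have hκ0 : 0 ≤ κ := le_trans (mul_nonneg hα (add_nonneg hη.le hβ)) hκ₁
  obtain ⟨z, hzε, hfix, hzb, -⟩ :=
    exists_fixedPt_of_lipschitz_of_norm_le (T := trajMap N η A B S y₀) hκ0 hκ hε
      (fun z z' hz hz' => lipschitz_trajMap hT hη hη1 hα hβ hσ hκ₁ hκ₂ hεr hz hz')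
      (fun z hz => norm_trajMap_le hT hη hη1 hα hβ hσ hκ₁ hκ₂ hε hεr hy₀ hz)
  have hzb' : ‖z‖ ≤ ‖y₀‖ / (1 - κ) :=
    hzb.trans (div_le_div_of_nonneg_right (norm_trajMap_zero_le hT) (by linarith))
  refine ⟨fun k => η ^ k • uAt N z k, fun k => η ^ k • vAt N z k,
    isTrajectory_of_fixedPt hη hfix, ?_, ?_⟩
  · intro k _
    have hηk : 0 ≤ η ^ k := pow_nonneg hη.le _
    simp only [norm_smul, Real.norm_of_nonneg hηk]
    exact ⟨by rw [mul_comm]; exact mul_le_mul_of_nonneg_right ((norm_uAt_le z k).trans hzε) hηk,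
      by rw [mul_comm]; exact mul_le_mul_of_nonneg_right ((norm_vAt_le z k).trans hzε) hηk⟩
  · intro k _
    have hηk : 0 ≤ η ^ k := pow_nonneg hη.le _
    simp only [norm_smul, Real.norm_of_nonneg hηk]
    exact ⟨mul_le_mul_of_nonneg_left ((norm_uAt_le z k).trans hzb') hηk,
      mul_le_mul_of_nonneg_left ((norm_vAt_le z k).trans hzb') hηk⟩

end existence

end RGFlow

end Literature.Dynamics.Hyperbolic

end
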